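import Summits.HodgeConjecture.HodgeConjecture.Theses.HeckeOrbitCompactness
import Literature.AlgebraicGeometry.HodgeTheory.ComplexConjugation

/-!
# Birth skeleton (BC3) for piece `WeilLinesRankOne` of the K-saturation split of `OrbitDegreeBound`
(stmt-HodgeConjecture-13689, route HeckeOrbitCompactness; crux-strategist 2026-08-17).

Stubs: `stub_H1PlusSpan` (the `+`-eigenspace `V₊` of `φ^*` on `H¹(A(ℂ); ℂ)` is spanned by
`≤ 2n` classes: `dim H¹ = 4n`, `H¹ = V₊ ⊕ V₋`, conjugation swaps them), `stub_wedgeTransfer`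
(`H²ⁿ = ⋀²ⁿ H¹` compatibly with pull-backs — the tree's `abelianVarietyCohomologyExteriorH1_holds`
— so the `(x + iy√d)^{2n}`-eigenclasses are `⋀²ⁿ V₊`, of rank `≤ C(2n, 2n) = 1`) and
`stub_conjSwap` (complex conjugation maps `E₋` into `E₊`: `conjClass_map`, `conjClass_smul`).
`WeilLinesRankOne_of`: `E₊` from the first two stubs, `E₋` by conjugating.
-/

-- `Summit.<Summit>.<Problem>` is the tree's mandated summit-side namespace (CONVENTIONS §2); deliberate duplicate.
set_option linter.dupNamespace false

namespace Summit.HodgeConjecture.HodgeConjecture.Cruxes.OrbitDegreeBound.WeilLinesRankOne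

open CategoryTheory
open Literature.AlgebraicGeometry Literature.AlgebraicGeometry.Motives
open Literature.AlgebraicGeometry.HodgeTheory
open Literature.AlgebraicTopology.SingularHomology

/-- Local copy of the piece (child item of the split; same text as filed). -/
def WeilLinesRankOne : Prop :=
  ∀ (n d : ℕ), 1 ≤ n → 0 < d → ∀ (A : Literature.AlgebraicGeometry.Motives.AbelianVariety ℂ) (φ : A ⟶ A), A.dim = 2 * n → Literature.AlgebraicGeometry.Motives.IsSmoothProjective (2 * n) A.X → CategoryTheory.CategoryStruct.comp φ φ = -(d • CategoryTheory.CategoryStruct.id A) → (∀ c ∈ Literature.AlgebraicGeometry.HodgeTheory.weilClassesPlus A φ n d, c ≠ 0 → ∀ c' ∈ Literature.AlgebraicGeometry.HodgeTheory.weilClassesPlus A φ n d, ∃ μ : ℂ, c' = μ • c) ∧ (∀ c ∈ Literature.AlgebraicGeometry.HodgeTheory.weilClassesMinus A φ n d, c ≠ 0 → ∀ c' ∈ Literature.AlgebraicGeometry.HodgeTheory.weilClassesMinus A φ n d, ∃ μ : ℂ, c' = μ • c)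

/-- STUB (M): `V₊ ⊆ H¹(A(ℂ); ℂ)` is spanned by at most `2n` classes. -/
theorem stub_H1PlusSpan : ∀ (n d : ℕ), 1 ≤ n → 0 < d → ∀ (A : Literature.AlgebraicGeometry.Motives.AbelianVariety ℂ) (φ : A ⟶ A), A.dim = 2 * n → Literature.AlgebraicGeometry.Motives.IsSmoothProjective (2 * n) A.X → CategoryTheory.CategoryStruct.comp φ φ = -(d • CategoryTheory.CategoryStruct.id A) → ∃ s : Finset (Literature.AlgebraicGeometry.HodgeTheory.complexBetti A.X 1), s.card ≤ 2 * n ∧ Literature.AlgebraicGeometry.HodgeTheory.pullbackEigenclasses A φ 1 (fun x y : ℕ => (x : ℂ) + (y : ℂ) * Complex.I * (Real.sqrt d : ℂ)) ≤ Submodule.span ℂ (s : Set (Literature.AlgebraicGeometry.HodgeTheory.complexBetti A.X 1)) := by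
  sorry

/-- STUB (L): exterior-power transfer — `E₊ = ⋀²ⁿ V₊` has rank ≤ 1 once `V₊` has `≤ 2n` generators. -/
theorem stub_wedgeTransfer : ∀ (n d : ℕ), 1 ≤ n → 0 < d → ∀ (A : Literature.AlgebraicGeometry.Motives.AbelianVariety ℂ) (φ : A ⟶ A), A.dim = 2 * n → Literature.AlgebraicGeometry.Motives.IsSmoothProjective (2 * n) A.X → CategoryTheory.CategoryStruct.comp φ φ = -(d • CategoryTheory.CategoryStruct.id A) → (∃ s : Finset (Literature.AlgebraicGeometry.HodgeTheory.complexBetti A.X 1), s.card ≤ 2 * n ∧ Literature.AlgebraicGeometry.HodgeTheory.pullbackEigenclasses A φ 1 (fun x y : ℕ => (x : ℂ) + (y : ℂ) * Complex.I * (Real.sqrt d : ℂ)) ≤ Submodule.span ℂ (s : Set (Literature.AlgebraicGeometry.HodgeTheory.complexBetti A.X 1))) → ∀ c ∈ Literature.AlgebraicGeometry.HodgeTheory.weilClassesPlus A φ n d, c ≠ 0 → ∀ c' ∈ Literature.AlgebraicGeometry.HodgeTheory.weilClassesPlus A φ n d, ∃ μ : ℂ, c' = μ • c := by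
  sorry

/-- LEMMA (was stub 3; PROVED here from the tree's conjugation API): complex conjugation maps
`E₋` into `E₊` — `conj` commutes with pull-backs (`conjClass_map`), is conjugate-linear
(`conjClass_smul`), and conjugates the character `(x - iy√d)^{2n}` into `(x + iy√d)^{2n}`.
[cite: VoisinHodgeI2002, Cor. 6.12] [cite: vanGeemen1994HodgeAV, proof of Lemma 5.2 (6)] -/
theorem stub_conjSwap : ∀ (n d : ℕ) (A : Literature.AlgebraicGeometry.Motives.AbelianVariety ℂ) (φ : A ⟶ A), ∀ c ∈ Literature.AlgebraicGeometry.HodgeTheory.weilClassesMinus A φ n d, Literature.AlgebraicGeometry.HodgeTheory.conjClass (Literature.AlgebraicGeometry.Motives.ComplexPoints A.X) (2 * n) c ∈ Literature.AlgebraicGeometry.HodgeTheory.weilClassesPlus A φ n d := by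
  intro n d A φ c hc
  rw [mem_weilClassesPlus_iff]
  intro x y
  have h := (mem_weilClassesMinus_iff.mp hc) x y
  rw [← conjClass_map, h, conjClass_smul]
  congr 1
  simp only [map_pow, map_sub, map_mul, map_natCast, Complex.conj_ofReal, Complex.conj_I]
  ring

/-- The composition: the three stubs give the piece. -/
theorem WeilLinesRankOne_of : (∀ (n d : ℕ), 1 ≤ n → 0 < d → ∀ (A : Literature.AlgebraicGeometry.Motives.AbelianVariety ℂ) (φ : A ⟶ A), A.dim = 2 * n → Literature.AlgebraicGeometry.Motives.IsSmoothProjective (2 * n) A.X → CategoryTheory.CategoryStruct.comp φ φ = -(d • CategoryTheory.CategoryStruct.id A) → ∃ s : Finset (Literature.AlgebraicGeometry.HodgeTheory.complexBetti A.X 1), s.card ≤ 2 * n ∧ Literature.AlgebraicGeometry.HodgeTheory.pullbackEigenclasses A φ 1 (fun x y : ℕ => (x : ℂ) + (y : ℂ) * Complex.I * (Real.sqrt d : ℂ)) ≤ Submodule.span ℂ (s : Set (Literature.AlgebraicGeometry.HodgeTheory.complexBetti A.X 1))) → (∀ (n d : ℕ), 1 ≤ n → 0 < d → ∀ (A : Literature.AlgebraicGeometry.Motives.AbelianVariety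 ℂ) (φ : A ⟶ A), A.dim = 2 * n → Literature.AlgebraicGeometry.Motives.IsSmoothProjective (2 * n) A.X → CategoryTheory.CategoryStruct.comp φ φ = -(d • CategoryTheory.CategoryStruct.id A) → (∃ s : Finset (Literature.AlgebraicGeometry.HodgeTheory.complexBetti A.X 1), s.card ≤ 2 * n ∧ Literature.AlgebraicGeometry.HodgeTheory.pullbackEigenclasses A φ 1 (fun x y : ℕ => (x : ℂ) + (y : ℂ) * Complex.I * (Real.sqrt d : ℂ)) ≤ Submodule.span ℂ (s : Set (Literature.AlgebraicGeometry.HodgeTheory.complexBetti A.X 1))) → ∀ c ∈ Literature.AlgebraicGeometry.HodgeTheory.weilClassesPlus A φ n d, c ≠ 0 → ∀ c' ∈ Literature.AlgebraicGeometry.HodgeTheory.weilClassesPlus A φ n d, ∃ μ : ℂ, c' = μ • c) → (∀ (n d : ℕ) (A : Literature.AlgebraicGeometry.Motives.AbelianVariety ℂ) (φ : A ⟶ A), ∀ c ∈ Literature.AlgebraicGeometry.HodgeTheory.weilClassesMinus A φ n d, Literature.AlgebraicGeometry.HodgeTheory.conjClass (Literature.AlgebraicGeometry.Motives.ComplexPoints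 A.X) (2 * n) c ∈ Literature.AlgebraicGeometry.HodgeTheory.weilClassesPlus A φ n d) → WeilLinesRankOne := by
  intro h1 h2 h3 n d hn hd A φ hA hsp hφ
  have hplus := h2 n d hn hd A φ hA hsp hφ (h1 n d hn hd A φ hA hsp hφ)
  refine ⟨hplus, ?_⟩
  intro c hc hc0 c' hc'
  have hcc := h3 n d A φ c hc
  have hcc' := h3 n d A φ c' hc'
  have hcc0 : conjClass (Motives.ComplexPoints A.X) (2 * n) c ≠ 0 := by
    intro h
    apply hc0
    rw [← conjClass_conjClass c, h, conjClass_zero]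
  obtain ⟨μ, hμ⟩ := hplus _ hcc hcc0 _ hcc'
  refine ⟨starRingEnd ℂ μ, ?_⟩
  rw [← conjClass_conjClass c', hμ, conjClass_smul, conjClass_conjClass]

end Summit.HodgeConjecture.HodgeConjecture.Cruxes.OrbitDegreeBound.WeilLinesRankOne
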